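import Literature.AlgebraicGeometry.RelativeSpec.GeometricQuotientFlatBaseChange
import Mathlib.Algebra.Category.Ring.Constructions
import HarnessLib

/-!
# Geometric quotients by finite groups of invertible order commute with ARBITRARY base change
# ([MFK94] Ch. 1 §2, Thm. 1.1 (1) and Amplification 1.3; SGA 1, Exp. V, Prop. 1.9)

SGA 1, Exp. V, Prop. 1.9 proves that the formation of `X/G` commutes with FLAT base change
(★ `ActionOver.isGeometricQuotient_baseChange_of_flat`) and warns «l'hypothèse de platitude était
essentielle … si `Y′` est un sous-préschéma fermé de `Y` (par exemple même un point fermé) … `Y′` ne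
s'identifie pas en général à `X′/G`». When the order of the finite group `G` is INVERTIBLE on the
quotient the restriction disappears: the Reynolds operator `E = |G|⁻¹ ∑_g g` splits the inclusion of
the invariants, and Mumford's argument ([MumfordFogartyKirwan1994] Ch. 1 §2, proof of Thm. 1.1,
statement (1) «if `S₀` is an `R₀`-algebra, then `S₀` is the ring of invariants in `R ⊗_{R₀} S₀`»,
whence Amplification 1.3 «in char. 0, `(Y, φ)` is actually a universal geometric quotient») makes
`X/G` a UNIVERSAL geometric quotient (Def. 0.7): for an AFFINE geometric quotient `p : X → Q`
(`ActionOver.IsGeometricQuotient`; e.g. the tree's `X → X/G`, any `finiteQuotient.mk`) by a finite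
group `G` with `|G| ∈ Γ(Q, 𝒪_Q)ˣ` (equivalently `∈ Γ(X, 𝒪_X)ˣ`, `IsGeometricQuotient.isUnit_natCast_iff`),
ANY `f : Y′ → Q` and a cartesian square `(f′, p′)` over `(p, f)` with `G` acting on `X′` over `Y′`
compatibly with `f′`, the base change `p′ : X′ → Y′` is a geometric quotient of `X′` by `G`
(`ActionOver.isGeometricQuotient_baseChange_of_isUnit_card`) — closed points and fibres included —
hence a categorical quotient for separated targets (`…existsUnique_desc_baseChange_of_isUnit_card`).

Proof (affine-locally, then ★ `ActionOver.isGeometricQuotient_of_range_app`, as in the flat case):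
for affine opens `W ⊆ Y′`, `V ⊆ Q` with `f(W) ⊆ V` the sections form a cocartesian square
`Γ(X′, p′⁻¹W) = Γ(Y′, W) ⊗_{Γ(Q,V)} Γ(X, p⁻¹V)` (`isIso_pushoutSection_of_isAffineOpen`) with
`Γ(Q, V) → Γ(X, p⁻¹V)` injective onto the invariants. The Reynolds retraction
(`exists_leftInverse_of_range_eq_setOf_forall_eq`) makes it a SPLIT injection, which survives any
base change (`injective_of_isBaseChange_of_leftInverse`), and an invariant `y` of `B ⊗_R A` satisfies
`|G| · y = ∑_g g·y ∈ B · (1 ⊗ A^G) = B` (`setOf_forall_eq_span_image_of_isBaseChange_of_isUnit_card`);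
this is Mumford's (2) for `p′` chartwise (`…injective_app_and_range_app_baseChange_of_isUnit_card`).
Everything is proved; no named facts and no definitions.

Mathlib searched (pin): `isIso_pushoutSection_of_isAffineOpen`, `CommRingCat.isPushout_iff_isPushout`,
`Algebra.IsPushout.out`, `IsBaseChange.equiv(_tmul)`, `IsBaseChange.linearMap`,
`LinearMap.lTensor_comp/_id`, `LinearEquiv.ofInjective`, `LinearMap.codRestrict`, `Equiv.sum_comp`,
`IsUnit.of_mul_eq_one`, `MorphismProperty.IsStableUnderBaseChange.of_isPullback` (all used); Mathlib
has no quotients of schemes by finite groups and no Reynolds operator over a general base ring.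

## References

* D. Mumford, J. Fogarty, F. Kirwan, *Geometric Invariant Theory*, 3rd ed. (1994), Ch. 0 §2
  Def. 0.7; Ch. 1 §2, Thm. 1.1 (1) and its proof (Reynolds operator), Amplification 1.3.
  [MumfordFogartyKirwan1994]
* A. Grothendieck, *SGA 1*, Exp. V, §1, Prop. 1.9 and the remark following it. [SGA1]
* D. Mumford, *Abelian Varieties* (1970), §7, Theorem p. 66. [MumfordAV1970]
-/

noncomputable section

universe u

open CategoryTheory Limits AlgebraicGeometry Opposite TensorProduct

namespace Literature.AlgebraicGeometry.RelativeSpec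

section Algebra

variable {R B : Type*} [CommRing R] [CommRing B] [Algebra R B]
  {M N M₂ N₂ : Type*} [AddCommGroup M] [Module R M] [AddCommGroup N] [Module R N] [Module B N]
  [IsScalarTower R B N] [AddCommGroup M₂] [Module R M₂] [AddCommGroup N₂] [Module R N₂] [Module B N₂]
  [IsScalarTower R B N₂] {j₁ : M →ₗ[R] N} {j₂ : M₂ →ₗ[R] N₂}

/-- A `B`-linear map extending an `R`-linear map along base changes is `1 ⊗ φ` transported along
the identifications `B ⊗_R M ≅ N`, `B ⊗_R M₂ ≅ N₂`. [folklore] -/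
private theorem apply_equiv_eq_equiv_lTensor (h₁ : IsBaseChange B j₁) (h₂ : IsBaseChange B j₂)
    (φ : M →ₗ[R] M₂) (φ' : N →ₗ[B] N₂) (hc : ∀ x, φ' (j₁ x) = j₂ (φ x)) (z : B ⊗[R] M) :
    φ' (h₁.equiv z) = h₂.equiv (φ.lTensor B z) := by
  induction z using TensorProduct.induction_on with
  | zero => simp
  | tmul c m => rw [LinearMap.lTensor_tmul, h₁.equiv_tmul, h₂.equiv_tmul, map_smul, hc]
  | add x y hx hy => rw [map_add, map_add, hx, hy, map_add, map_add]

/-- **A split injection stays injective after any base change**: if `φ : M → M₂` has an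
`R`-linear left inverse `ψ` and `φ' : N → N₂` is `B`-linear extending `φ` along base changes to an
ARBITRARY `R`-algebra `B`, then `φ'` (`≅ 1_B ⊗ φ`, left inverse `1_B ⊗ ψ`) is injective («`R ≅ R₀ ⊕ R₁`
as an `R₀`-module, therefore … `S₀` is a subring of `R ⊗_{R₀} S₀`»).
[cite: MumfordFogartyKirwan1994, Ch. 1 §2 Thm. 1.1 (proof of (1))] -/
theorem injective_of_isBaseChange_of_leftInverse (h₁ : IsBaseChange B j₁) (h₂ : IsBaseChange B j₂)
    (φ : M →ₗ[R] M₂) (ψ : M₂ →ₗ[R] M) (hψ : ∀ x, ψ (φ x) = x) (φ' : N →ₗ[B] N₂)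
    (hc : ∀ x, φ' (j₁ x) = j₂ (φ x)) : Function.Injective φ' := by
  intro x y hxy
  obtain ⟨z, rfl⟩ := h₁.equiv.surjective x
  obtain ⟨w, rfl⟩ := h₁.equiv.surjective y
  rw [apply_equiv_eq_equiv_lTensor h₁ h₂ φ φ' hc, apply_equiv_eq_equiv_lTensor h₁ h₂ φ φ' hc] at hxy
  have hcomp : ψ ∘ₗ φ = LinearMap.id := LinearMap.ext hψ
  have key : ∀ v : B ⊗[R] M, (ψ.lTensor B) (φ.lTensor B v) = v := fun v => by
    rw [← LinearMap.comp_apply, ← LinearMap.lTensor_comp, hcomp, LinearMap.lTensor_id,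
      LinearMap.id_apply]
  rw [← key z, ← key w, h₂.equiv.injective hxy]

variable {G : Type*} [Group G]

/-- The sum `∑_g S g x` over a group acting through `S` is invariant. [folklore] -/
private theorem apply_sum_eq_sum [Fintype G] (S : G → M →ₗ[R] M)
    (hmul : ∀ g h x, S (g * h) x = S g (S h x)) (h : G) (x : M) :
    S h (∑ g, S g x) = ∑ g, S g x := by
  rw [map_sum]
  simp_rw [← hmul]
  exact Equiv.sum_comp (Equiv.mulLeft h) (fun g => S g x)

/-- **The Reynolds retraction.** If `ι : M → M₂` is injective with image the joint fixed points of
a finite group `G` acting `R`-linearly on `M₂` and `|G| ∈ Rˣ`, then `ι` has an `R`-linear left inverse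
(`|G|⁻¹ ∑_g g` followed by `ι⁻¹`): the inclusion of the invariants is SPLIT.
[cite: MumfordFogartyKirwan1994, Ch. 1 §2 Thm. 1.1 (proof, Reynolds operator)] -/
theorem exists_leftInverse_of_range_eq_setOf_forall_eq [Finite G] (ι : M →ₗ[R] M₂)
    (hι : Function.Injective ι) (S : G → M₂ →ₗ[R] M₂) (hmul : ∀ g h x, S (g * h) x = S g (S h x))
    (hrange : Set.range ι = {x | ∀ g : G, S g x = x}) (hG : IsUnit ((Nat.card G : ℕ) : R)) :
    ∃ ψ : M₂ →ₗ[R] M, ∀ m, ψ (ι m) = m := by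
  classical
  cases nonempty_fintype G
  obtain ⟨u, hu⟩ := hG
  rw [Nat.card_eq_fintype_card] at hu
  -- the trace `T = ∑_g g` lands in the invariants `= range ι`
  let T : M₂ →ₗ[R] M₂ := ∑ g, S g
  have hT : ∀ x, T x = ∑ g, S g x := fun x => by simp [T, LinearMap.sum_apply]
  have hTmem : ∀ x, T x ∈ LinearMap.range ι := fun x => by
    have hx : T x ∈ {x | ∀ g : G, S g x = x} := fun h => by rw [hT, apply_sum_eq_sum S hmul]
    exact LinearMap.mem_range.mpr (by rwa [← hrange] at hx)
  -- `ψ₀ = ι⁻¹ ∘ T`, with `ψ₀ (ι m) = |G| • m`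
  let ψ₀ : M₂ →ₗ[R] M :=
    (LinearEquiv.ofInjective ι hι).symm.toLinearMap ∘ₗ T.codRestrict (LinearMap.range ι) hTmem
  have hψ₀ : ∀ x, ι (ψ₀ x) = T x := fun x => by
    rw [← LinearEquiv.ofInjective_apply ι (h := hι) (ψ₀ x)]
    change ((LinearEquiv.ofInjective ι hι) ((LinearEquiv.ofInjective ι hι).symm
      (T.codRestrict (LinearMap.range ι) hTmem x)) : M₂) = T x
    rw [LinearEquiv.apply_symm_apply, LinearMap.codRestrict_apply]
  have hψ₀ι : ∀ m, ψ₀ (ι m) = (u : R) • m := fun m => by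
    apply hι
    rw [hψ₀, hT, map_smul, hu, Nat.cast_smul_eq_nsmul]
    have hm : ι m ∈ {x | ∀ g : G, S g x = x} := by rw [← hrange]; exact ⟨m, rfl⟩
    simp only [Set.mem_setOf_eq] at hm
    simp_rw [hm]
    rw [Finset.sum_const, Finset.card_univ]
  refine ⟨(↑u⁻¹ : R) • ψ₀, fun m => ?_⟩
  rw [LinearMap.smul_apply, hψ₀ι, smul_smul, Units.inv_mul, one_smul]

/-- **Invariants commute with arbitrary base change when `|G|` is a unit** ([MFK94] Ch. 1 §2,
Thm. 1.1 (1) «if `S₀` is an `R₀`-algebra, then `S₀` is the ring of invariants in `R ⊗_{R₀} S₀`», in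
module form): for a base change `j : M → N` to ANY `R`-algebra `B`, a finite group `G` acting
`R`-linearly on `M` through `S` with `B`-linear extensions `S'`, and `|G| ∈ Rˣ`, the invariants of `N`
are the `B`-span of the image of the invariants of `M` (for invariant `y`,
`|G| · y = ∑_g S' g y = (1 ⊗ ∑_g S g) y ∈ B · j(M^G)`). Flat twin: ★ `…_of_isBaseChange_of_flat`.
[cite: MumfordFogartyKirwan1994, Ch. 1 §2 Thm. 1.1 (1)] -/
theorem setOf_forall_eq_span_image_of_isBaseChange_of_isUnit_card [Finite G]
    (hj : IsBaseChange B j₁) (S : G → M →ₗ[R] M) (S' : G → N →ₗ[B] N)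
    (hS : ∀ g x, S' g (j₁ x) = j₁ (S g x)) (hmul : ∀ g h x, S (g * h) x = S g (S h x))
    (hG : IsUnit ((Nat.card G : ℕ) : R)) :
    {y : N | ∀ g : G, S' g y = y} = Submodule.span B (j₁ '' {x | ∀ g : G, S g x = x}) := by
  classical
  cases nonempty_fintype G
  obtain ⟨u, hu⟩ := hG.map (algebraMap R B)
  rw [map_natCast, Nat.card_eq_fintype_card] at hu
  apply Set.Subset.antisymm
  · intro y hy
    -- the traces `T = ∑_g S g` on `M` and `T' = ∑_g S' g = 1 ⊗ T` on `N`
    let T : M →ₗ[R] M := ∑ g, S g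
    let T' : N →ₗ[B] N := ∑ g, S' g
    have hT : ∀ x, T x = ∑ g, S g x := fun x => by simp [T, LinearMap.sum_apply]
    have hT' : ∀ y, T' y = ∑ g, S' g y := fun y => by simp [T', LinearMap.sum_apply]
    have hTT' : ∀ x, T' (j₁ x) = j₁ (T x) := fun x => by rw [hT', hT, map_sum]; simp_rw [hS]
    -- `T' y = |G| • y`
    have hTy : T' y = (u : B) • y := by
      rw [hT', hu, Nat.cast_smul_eq_nsmul]
      have hy' : ∀ g : G, S' g y = y := hy
      simp_rw [hy']
      rw [Finset.sum_const, Finset.card_univ]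
    -- `T' y ∈ B · j(M^G)`
    have hmem : ∀ z : B ⊗[R] M,
        hj.equiv (T.lTensor B z) ∈ Submodule.span B (j₁ '' {x | ∀ g : G, S g x = x}) := fun z => by
      induction z using TensorProduct.induction_on with
      | zero => rw [map_zero, map_zero]; exact Submodule.zero_mem _
      | tmul b m =>
        rw [LinearMap.lTensor_tmul, hj.equiv_tmul]
        refine Submodule.smul_mem _ b (Submodule.subset_span ⟨T m, fun h => ?_, rfl⟩)
        rw [hT, apply_sum_eq_sum S hmul]
      | add x y hx hy => rw [map_add, map_add]; exact Submodule.add_mem _ hx hy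
    obtain ⟨z, rfl⟩ := hj.equiv.surjective y
    have h1 := hmem z
    rw [← apply_equiv_eq_equiv_lTensor hj hj T T' hTT', hTy] at h1
    have h2 := Submodule.smul_mem _ (↑u⁻¹ : B) h1
    rwa [smul_smul, Units.inv_mul, one_smul] at h2
  · have h : Submodule.span B (j₁ '' {x | ∀ g : G, S g x = x}) ≤
        ⨅ g : G, LinearMap.eqLocus (S' g) LinearMap.id := by
      rw [Submodule.span_le]
      rintro _ ⟨x, hx, rfl⟩
      simp only [SetLike.mem_coe, Submodule.mem_iInf, LinearMap.mem_eqLocus, LinearMap.id_apply]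
      intro g
      rw [hS, hx g]
    intro y hy
    simpa only [Submodule.mem_iInf, LinearMap.mem_eqLocus, LinearMap.id_apply, Set.mem_setOf_eq]
      using h hy

end Algebra

/-- Pointwise `f♯ (g♯ s) = h♯ s` on compatible opens when `f ≫ g = h`. [folklore] -/
private theorem appLE_appLE_apply_of_comp_eq' {X Y Z : Scheme.{u}} {f : X ⟶ Y} {g : Y ⟶ Z}
    {h : X ⟶ Z} (e : f ≫ g = h) (U : Z.Opens) (V : Y.Opens) (W : X.Opens) (hV : V ≤ g ⁻¹ᵁ U)
    (hW : W ≤ f ⁻¹ᵁ V) (hW' : W ≤ h ⁻¹ᵁ U) (s : Γ(Z, U)) :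
    f.appLE V W hW (g.appLE U V hV s) = h.appLE U W hW' s := by
  subst e
  rw [← CommRingCat.comp_apply, Scheme.Hom.appLE_comp_appLE]

namespace ActionOver

variable {X Y Q X' Y' : Scheme.{u}} {r : X ⟶ Y} {p : X ⟶ Q} {f : Y' ⟶ Q} {p' : X' ⟶ Y'}
  {f' : X' ⟶ X} {G : Type*} [Group G] (ρ : ActionOver r G)

set_option backward.isDefEq.respectTransparency false

/-- **`n` is a unit downstairs iff upstairs.** For a geometric quotient `p : X → Q`, `n` is a unit
of `Γ(Q, W)` iff it is a unit of `Γ(X, p⁻¹W)` (`p♯` is injective onto the invariants and the inverse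
of the invariant `n` is invariant) — so the hypothesis `|G| ∈ Γ(Q, 𝒪)ˣ` below may be checked on `X`,
e.g. for `X` over a field of characteristic prime to `|G|`. [cite: MumfordAV1970, §7 Thm. p. 66 (2)] -/
theorem IsGeometricQuotient.isUnit_natCast_iff (hq : ρ.IsGeometricQuotient p) (W : Q.Opens) (n : ℕ) :
    IsUnit (n : Γ(Q, W)) ↔ IsUnit (n : Γ(X, p ⁻¹ᵁ W)) := by
  refine ⟨fun h => by simpa using h.map (p.app W).hom, ?_⟩
  rintro ⟨u, hu⟩
  have hO := ρ.preimage_le_aut_preimage p hq.comp_eq W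
  -- `u⁻¹` is invariant (inverses are unique), hence descends along `p♯`
  have hinv : (↑u⁻¹ : Γ(X, p ⁻¹ᵁ W)) ∈ Set.range (p.app W) := by
    rw [hq.range_app W]
    show ∀ g : G, _
    intro g
    have h1 : ρ.actOn (p ⁻¹ᵁ W) hO g ↑u⁻¹ * ↑u = 1 := by
      rw [hu, ← map_natCast (ρ.actOn (p ⁻¹ᵁ W) hO g) n, ← map_mul, ← hu, u.inv_mul, map_one]
    calc ρ.actOn (p ⁻¹ᵁ W) hO g ↑u⁻¹ = ρ.actOn (p ⁻¹ᵁ W) hO g ↑u⁻¹ * (↑u * ↑u⁻¹) := by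
          rw [u.mul_inv, mul_one]
      _ = ↑u⁻¹ := by rw [← mul_assoc, h1, one_mul]
  obtain ⟨t, ht⟩ := hinv
  refine IsUnit.of_mul_eq_one t (hq.app_injective W ?_)
  rw [map_mul, map_natCast, ht, map_one, ← hu, u.mul_inv]

/-- **Mumford's condition (2) after an ARBITRARY base change, `|G|` a unit, on the affine opens of
`Y′` over affine opens of `Q`.**  For an affine geometric quotient `p : X → Q` by a finite group `G`,
an affine open `V ⊆ Q` with `|G| ∈ Γ(Q, V)ˣ`, any `f : Y′ → Q`, a cartesian square `(f′, p′)` over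
`(p, f)` with the compatible action on `X′`, and an affine open `W ⊆ f⁻¹V` of `Y′`:
`p′♯ : Γ(Y′, W) → Γ(X′, p′⁻¹W)` is injective with image the `G`-invariants (cocartesian square of
sections `Γ(X′, p′⁻¹W) = Γ(Y′, W) ⊗_{Γ(Q,V)} Γ(X, p⁻¹V)` + the Reynolds retraction + invariants under
base change). [cite: MumfordFogartyKirwan1994, Ch. 1 §2 Thm. 1.1 (1), Amplification 1.3]
[cite: MumfordAV1970, §7 Thm. p. 66 (2)] -/
theorem injective_app_and_range_app_baseChange_of_isUnit_card [Finite G]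
    (hq : ρ.IsGeometricQuotient p) [IsAffineHom p] (H : IsPullback f' p' p f) (ρ' : ActionOver p' G)
    (hρ' : ∀ g : G, (ρ'.aut g).hom ≫ f' = f' ≫ (ρ.aut g).hom)
    (V : Q.affineOpens) (hG : IsUnit ((Nat.card G : ℕ) : Γ(Q, (V : Q.Opens))))
    (W : Y'.affineOpens) (hWV : (W : Y'.Opens) ≤ f ⁻¹ᵁ (V : Q.Opens)) :
    Function.Injective (p'.app W.1) ∧
      Set.range (p'.app W.1) = {s | ∀ g : G, ρ'.act g W.1 s = s} := by
  let A₀ : X.Opens := p ⁻¹ᵁ V.1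
  have hA₀ : IsAffineOpen A₀ := V.2.preimage p
  let A₁ : X'.Opens := p' ⁻¹ᵁ W.1
  have hA₁le : A₁ ≤ f' ⁻¹ᵁ A₀ := by
    change p' ⁻¹ᵁ W.1 ≤ f' ⁻¹ᵁ (p ⁻¹ᵁ V.1)
    rw [← Scheme.Hom.comp_preimage, H.w, Scheme.Hom.comp_preimage]
    exact p'.preimage_mono hWV
  have hA₁ : A₁ = f' ⁻¹ᵁ A₀ ⊓ p' ⁻¹ᵁ W.1 := le_antisymm (le_inf hA₁le le_rfl) inf_le_right
  have eA₀ : ∀ g : G, A₀ ≤ (ρ.aut g).hom ⁻¹ᵁ A₀ := ρ.preimage_le_aut_preimage p hq.comp_eq V.1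
  have eA₁ : ∀ g : G, A₁ ≤ (ρ'.aut g).hom ⁻¹ᵁ A₁ := fun g => (ρ'.preimage_preimage g W.1).ge
  -- the cocartesian square of sections `Γ(X', A₁) = Γ(Y', W) ⊗_{Γ(Q, V)} Γ(X, A₀)`
  have PX := (isIso_pushoutSection_iff H hWV (le_refl A₀) hA₁).mp
    (isIso_pushoutSection_of_isAffineOpen H hWV (le_refl A₀) hA₁ V.2 W.2 hA₀)
  letI algA : Algebra Γ(Q, V.1) Γ(X, A₀) := (p.appLE V.1 A₀ le_rfl).hom.toAlgebra
  letI algB : Algebra Γ(Q, V.1) Γ(Y', W.1) := (f.appLE V.1 W.1 hWV).hom.toAlgebra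
  letI algAA' : Algebra Γ(X, A₀) Γ(X', A₁) := (f'.appLE A₀ A₁ hA₁le).hom.toAlgebra
  letI algBA' : Algebra Γ(Y', W.1) Γ(X', A₁) := (p'.appLE W.1 A₁ le_rfl).hom.toAlgebra
  letI alg0A' : Algebra Γ(Q, V.1) Γ(X', A₁) :=
    ((algebraMap Γ(Y', W.1) Γ(X', A₁)).comp (algebraMap Γ(Q, V.1) Γ(Y', W.1))).toAlgebra
  haveI : IsScalarTower Γ(Q, V.1) Γ(Y', W.1) Γ(X', A₁) := IsScalarTower.of_algebraMap_eq' rfl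
  haveI : IsScalarTower Γ(Q, V.1) Γ(X, A₀) Γ(X', A₁) :=
    IsScalarTower.of_algebraMap_eq' (RingHom.ext fun c => (ConcreteCategory.congr_hom PX.w c).symm)
  have hj := (CommRingCat.isPushout_iff_isPushout.mp PX.flip : Algebra.IsPushout Γ(Q, V.1)
    Γ(Y', W.1) Γ(X, A₀) Γ(X', A₁)).out
  have hLc : ∀ (g : G) (c : Γ(Q, V.1)),
      ρ.actOn A₀ eA₀ g (algebraMap Γ(Q, V.1) Γ(X, A₀) c) = algebraMap Γ(Q, V.1) Γ(X, A₀) c := fun g c => by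
    change ρ.actOn (p ⁻¹ᵁ V.1) eA₀ g (p.appLE V.1 A₀ le_rfl c) = p.appLE V.1 A₀ le_rfl c
    rw [← Scheme.Hom.app_eq_appLE]
    exact ρ.actOn_app p hq.comp_eq g V.1 c
  let L : G → (Γ(X, A₀) →ₐ[Γ(Q, V.1)] Γ(X, A₀)) := fun g =>
    { toRingHom := ρ.actOn A₀ eA₀ g, commutes' := hLc g }
  have hLmul : ∀ (g h : G) (a : Γ(X, A₀)),
      (L (g * h)).toLinearMap a = (L g).toLinearMap ((L h).toLinearMap a) := fun g h a => by
    -- = ★ `ActionOver.actOn_mul` (`Motives/FiniteQuotientClosedImmersion`), inlined to keep the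
    -- `RelativeSpec` import cone free of `Motives`
    change ρ.actOn A₀ eA₀ (g * h) a = ρ.actOn A₀ eA₀ g (ρ.actOn A₀ eA₀ h a)
    simp only [actOn_apply]
    rw [← CommRingCat.comp_apply, Scheme.Hom.appLE_comp_appLE]
    have e : (ρ.aut (g * h)⁻¹).hom = (ρ.aut g⁻¹).hom ≫ (ρ.aut h⁻¹).hom := by
      rw [mul_inv_rev, map_mul, Aut.Aut_mul_def]; rfl
    simp only [Scheme.Hom.appLE, Scheme.Hom.congr_app e, Category.assoc, ← Functor.map_comp]
    rfl
  have hL'c : ∀ (g : G) (b : Γ(Y', W.1)),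
      ρ'.act g W.1 (algebraMap Γ(Y', W.1) Γ(X', A₁) b) = algebraMap Γ(Y', W.1) Γ(X', A₁) b := fun g b => by
    change ρ'.act g W.1 (p'.appLE W.1 A₁ le_rfl b) = p'.appLE W.1 A₁ le_rfl b
    rw [← Scheme.Hom.app_eq_appLE]
    exact ρ'.act_app g W.1 b
  let L' : G → (Γ(X', A₁) →ₐ[Γ(Y', W.1)] Γ(X', A₁)) := fun g =>
    { toRingHom := ρ'.act g W.1, commutes' := hL'c g }
  -- compatibility of the actions with `f'♯ : A → A'`
  have hA₁le' : ∀ g : G, A₁ ≤ ((ρ'.aut g⁻¹).hom ≫ f') ⁻¹ᵁ A₀ := fun g => by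
    rw [Scheme.Hom.comp_preimage]
    exact (eA₁ g⁻¹).trans ((ρ'.aut g⁻¹).hom.preimage_mono hA₁le)
  have hLL' : ∀ (g : G) (a : Γ(X, A₀)),
      (L' g).toLinearMap ((IsScalarTower.toAlgHom Γ(Q, V.1) Γ(X, A₀) Γ(X', A₁)).toLinearMap a) =
        (IsScalarTower.toAlgHom Γ(Q, V.1) Γ(X, A₀) Γ(X', A₁)).toLinearMap ((L g).toLinearMap a) :=
    fun g a => by
    change ρ'.act g W.1 (f'.appLE A₀ A₁ hA₁le a) = f'.appLE A₀ A₁ hA₁le (ρ.actOn A₀ eA₀ g a)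
    rw [act_apply, actOn_apply,
      appLE_appLE_apply_of_comp_eq' rfl A₀ A₁ A₁ hA₁le (eA₁ g⁻¹) (hA₁le' g),
      appLE_appLE_apply_of_comp_eq' (hρ' g⁻¹).symm A₀ A₀ A₁ (eA₀ g⁻¹) hA₁le (hA₁le' g)]
  have hinj₀ : Function.Injective (Algebra.linearMap Γ(Q, V.1) Γ(X, A₀)) := by
    change Function.Injective (p.appLE V.1 A₀ le_rfl)
    rw [← Scheme.Hom.app_eq_appLE]
    exact hq.app_injective V.1
  have hrange : Set.range (Algebra.linearMap Γ(Q, V.1) Γ(X, A₀)) =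
      {x | ∀ g : G, (L g).toLinearMap x = x} := by
    change Set.range (p.appLE V.1 A₀ le_rfl) = _
    rw [← Scheme.Hom.app_eq_appLE]
    exact hq.range_app V.1
  have hsq : ∀ c, algebraMap Γ(Y', W.1) Γ(X', A₁) (algebraMap Γ(Q, V.1) Γ(Y', W.1) c) =
      algebraMap Γ(X, A₀) Γ(X', A₁) (algebraMap Γ(Q, V.1) Γ(X, A₀) c) := fun c => by
    rw [← IsScalarTower.algebraMap_apply, ← IsScalarTower.algebraMap_apply]
  -- (i) injectivity of `p'♯ = algebraMap B A'`: the Reynolds retraction splits `p♯`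
  obtain ⟨ψ, hψ⟩ := exists_leftInverse_of_range_eq_setOf_forall_eq
    (Algebra.linearMap Γ(Q, V.1) Γ(X, A₀)) hinj₀ (fun g => (L g).toLinearMap) hLmul hrange hG
  have hinj : Function.Injective (algebraMap Γ(Y', W.1) Γ(X', A₁)) :=
    injective_of_isBaseChange_of_leftInverse (IsBaseChange.linearMap Γ(Q, V.1) Γ(Y', W.1)) hj
      (Algebra.linearMap Γ(Q, V.1) Γ(X, A₀)) ψ hψ (Algebra.linearMap Γ(Y', W.1) Γ(X', A₁)) hsq
  -- (ii) invariants commute with the base change since `|G|` is a unit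
  have key := setOf_forall_eq_span_image_of_isBaseChange_of_isUnit_card hj
    (fun g => (L g).toLinearMap) (fun g => (L' g).toLinearMap) hLL' hLmul hG
  refine ⟨by rw [Scheme.Hom.app_eq_appLE]; exact hinj, Set.Subset.antisymm ?_ ?_⟩
  · rintro _ ⟨b, rfl⟩ g
    exact ρ'.act_app g W.1 b
  · intro s hs
    have hs' : s ∈ {y : Γ(X', A₁) | ∀ g : G, (L' g).toLinearMap y = y} := hs
    rw [key] at hs'
    have hle : Submodule.span Γ(Y', W.1)
        ((IsScalarTower.toAlgHom Γ(Q, V.1) Γ(X, A₀) Γ(X', A₁)).toLinearMap ''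
          {x | ∀ g : G, (L g).toLinearMap x = x}) ≤
        LinearMap.range (Algebra.linearMap Γ(Y', W.1) Γ(X', A₁)) := by
      rw [Submodule.span_le]
      rintro _ ⟨x, hx, rfl⟩
      rw [← hrange] at hx
      obtain ⟨c, rfl⟩ := hx
      exact ⟨algebraMap Γ(Q, V.1) Γ(Y', W.1) c, hsq c⟩
    obtain ⟨b, hb⟩ := hle hs'
    exact ⟨b, by rw [Scheme.Hom.app_eq_appLE]; exact hb⟩

/-- **Geometric quotients by finite groups of invertible order commute with ARBITRARY base change**
([MFK94] Ch. 1 §2 Amplification 1.3: a UNIVERSAL geometric quotient, Def. 0.7).  Let the finite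
group `G` act on `X` (over any base), let `p : X → Q` be an AFFINE geometric quotient (Mumford's (1),
(2); e.g. the tree's `X → X/G`) with `|G| ∈ Γ(Q, 𝒪_Q)ˣ`, let `f : Y′ → Q` be ANY morphism (a closed
point, a fibre, a non-flat base, …) and `(f′, p′)` a cartesian square over `(p, f)` (e.g.
`pullback.fst`/`pullback.snd`) with an action of `G` on `X′` over `Y′` compatible with `f′`.  Then
`p′` is a geometric quotient of `X′` by `G`.  Flat twin: ★ `isGeometricQuotient_baseChange_of_flat`.
[cite: MumfordFogartyKirwan1994, Ch. 1 §2 Amplification 1.3, Ch. 0 §2 Def. 0.7]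
[cite: MumfordAV1970, §7 Thm. p. 66] -/
theorem isGeometricQuotient_baseChange_of_isUnit_card [Finite G] (hq : ρ.IsGeometricQuotient p)
    [IsAffineHom p] (hG : IsUnit ((Nat.card G : ℕ) : Γ(Q, ⊤))) (H : IsPullback f' p' p f)
    (ρ' : ActionOver p' G) (hρ' : ∀ g : G, (ρ'.aut g).hom ≫ f' = f' ≫ (ρ.aut g).hom) :
    ρ'.IsGeometricQuotient p' := by
  haveI : IsAffineHom p' := MorphismProperty.IsStableUnderBaseChange.of_isPullback H inferInstance
  have hGV : ∀ V : Q.affineOpens, IsUnit ((Nat.card G : ℕ) : Γ(Q, (V : Q.Opens))) := fun V => by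
    simpa using hG.map (Q.presheaf.map (homOfLE (le_top (a := (V : Q.Opens)))).op).hom
  let ι := {i : Y'.affineOpens × Q.affineOpens // (i.1 : Y'.Opens) ≤ f ⁻¹ᵁ (i.2 : Q.Opens)}
  have h2 := fun i : ι =>
    ρ.injective_app_and_range_app_baseChange_of_isUnit_card hq H ρ' hρ' i.1.2 (hGV i.1.2) i.1.1 i.2
  refine ρ'.isGeometricQuotient_of_range_app (fun i : ι => i.1.1) ?_ (fun i => (h2 i).1)
    (fun i => (h2 i).2)
  rw [eq_top_iff]
  rintro y -
  obtain ⟨V, hyV⟩ : ∃ V : Q.affineOpens, f y ∈ (V : Q.Opens) := by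
    have h : f y ∈ (⊤ : Q.Opens) := trivial
    rwa [← iSup_affineOpens_eq_top Q, TopologicalSpace.Opens.mem_iSup] at h
  obtain ⟨W, hW, hyW, hWV⟩ :=
    (TopologicalSpace.Opens.isBasis_iff_nbhd.mp Y'.isBasis_affineOpens) (show y ∈ f ⁻¹ᵁ V.1 from hyV)
  exact TopologicalSpace.Opens.mem_iSup.mpr ⟨⟨(⟨W, hW⟩, V), hWV⟩, hyW⟩

/-- **Universal property after arbitrary base change** ([MFK94] Def. 0.7: a universal geometric
quotient is a universal categorical quotient): every `G`-invariant morphism from `X′` to a separated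
scheme factors uniquely through `p′`. [cite: MumfordFogartyKirwan1994, Ch. 0 §2 Def. 0.7, Prop. 0.1] -/
theorem existsUnique_desc_baseChange_of_isUnit_card [Finite G] (hq : ρ.IsGeometricQuotient p)
    [IsAffineHom p] (hG : IsUnit ((Nat.card G : ℕ) : Γ(Q, ⊤))) (H : IsPullback f' p' p f)
    (ρ' : ActionOver p' G) (hρ' : ∀ g : G, (ρ'.aut g).hom ≫ f' = f' ≫ (ρ.aut g).hom)
    {Z : Scheme.{u}} [Z.IsSeparated] (φ : X' ⟶ Z) (hφ : ∀ g : G, (ρ'.aut g).hom ≫ φ = φ) :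
    ∃! ψ : Y' ⟶ Z, p' ≫ ψ = φ :=
  (ρ.isGeometricQuotient_baseChange_of_isUnit_card hq hG H ρ' hρ').existsUnique_desc φ hφ

end ActionOver

end Literature.AlgebraicGeometry.RelativeSpec

end
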